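import Summits.ValiantsHypothesis.ValiantsHypothesis.Theorems.DivisionGapPerDivisionHardColContentExt
import Summits.ValiantsHypothesis.ValiantsHypothesis.Theorems.DivisionGapPerDivisionHardCellContentExt
import Summits.ValiantsHypothesis.ValiantsHypothesis.Theorems.DivisionGapPerDivisionHardLowRankProduct
import Summits.ValiantsHypothesis.ValiantsHypothesis.Theorems.DivisionGapPerDivisionHardLowPartialDegree

/-!
# Line `pair-descent-jss-endpoint` — the RANK CHAPTER (skeleton v13–v14, lead seat c9, 2026-08-17): a sorry-free index

Companion workfile of `Lines/pair_descent_jss_endpoint.lean` (which is at the 200 kB cap).  Every statement below is a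
LANDED tree theorem (rung files `Theorems/DivisionGapPerDivisionHard{ColContent,ColContentExt,CellContent,CellContentExt}.lean`,
p156844 / p157525 / p159174 / p159525, `…LowRankProduct.lean` p160827, `…LowPartialDegree.lean` p160262; stubs p154909 p155050 p155024 p155460 p157212 p157155 p157259 p158863 p158261 p158180
p158588 p158462 p158385 p159116); this file only re-exports them under one roof so that planners / strategists can read the
chapter in one place and the farm re-checks that the names resolve.  Prose: dossiers v9, v10.

THE CHAPTER IN ONE SENTENCE.  For every `c` there are `e, n₀` such that for `n ≥ n₀` and every partition of the `n²` matrix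
variables into `Y, Yᶜ` with `n² ≤ 4|Y| ≤ 3n²`: every nonzero cofactor `h` whose monomials have at most `2^{n/(log₂ n+e)^e}`
distinct `Y`-contents `Φ_Y(m) = ((Σ_{c:(r,c)∈Y} m(r,c))_r, (Σ_{r:(r,c)∈Y} m(r,c))_c)` — e.g. every `h` of monotone
(Nisan–Raz) rank `≤ 2^{n/(log₂ n+e)^e}` across `(Y, Yᶜ)`: `Σ_{t<W} f_t(x_Y)·g_t(x_{Yᶜ})`, entries of monotone oblivious ABPs
of that width in any variable order split at a balanced point — satisfies `2^{(log₂ n+c)^c} < L(per_n·h) + L(h)`;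
and so does every PRODUCT of arbitrarily many factors whose contents lie in a common set of size `≤ 2^{(log₂ n+c)^c}`
(e.g. `h_bal`, decided here by rank as in cycle c3 by prices).
Mechanism: the prover's freedom of PLACEMENT (alternating / greedy rows against live columns) makes the linear invariant
`Φ_Y` detect every nonzero circulation of the placed block face on `≥ k-1` core columns, so the union bound runs over pairs
of RANK CLASSES instead of pairs of monomials.  Residual: the undecided cofactor is full-rank for EVERY balanced partition.
-/

noncomputable section

set_option linter.dupNamespace false

namespace Summit.ValiantsHypothesis.ValiantsHypothesis.Cruxes.PerDivisionHard.PairDescentJssEndpoint.RankChapter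

open MvPolynomial Literature.Computability.AlgebraicComplexity
open Summit.ValiantsHypothesis.ValiantsHypothesis.Theorems.DivisionGapPerDivisionHard
open scoped NNReal

/-- Row cut, quasi-polynomial rank (p156844). [folklore] -/
theorem colContent :
    ∀ c : ℕ, ∃ n₀ : ℕ, ∀ n ≥ n₀, ∀ h : MvPolynomial (Fin n × Fin n) ℝ≥0, h ≠ 0 →
      ∀ A : Finset (Fin n), n ≤ 4 * A.card → 4 * A.card ≤ 3 * n →
      (h.support.image fun (mm : (Fin n × Fin n) →₀ ℕ) (cc : Fin n) => ∑ r ∈ A, mm (r, cc)).card ≤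
          2 ^ ((Nat.log 2 n + c) ^ c) →
      2 ^ ((Nat.log 2 n + c) ^ c) <
        complexity (perPoly (Fin n) ℝ≥0 * h) + complexity h :=
  perDivisionHard_colContent

/-- Row-split sums `Σ f_t(rows A)·g_t(rows Aᶜ)`, `f, g` arbitrary (p156844). [folklore] -/
theorem rowSplit :
    ∀ c : ℕ, ∃ n₀ : ℕ, ∀ n ≥ n₀, ∀ (W : ℕ) (A : Finset (Fin n))
      (f g : Fin W → MvPolynomial (Fin n × Fin n) ℝ≥0),
      n ≤ 4 * A.card → 4 * A.card ≤ 3 * n → W ≤ 2 ^ ((Nat.log 2 n + c) ^ c) →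
      ∑ t, f t * g t ≠ 0 →
      (∀ t, ∀ mm ∈ (f t).support, ∀ e ∈ mm.support, e.1 ∈ A) →
      (∀ t, ∀ mm ∈ (g t).support, ∀ e ∈ mm.support, e.1 ∉ A) →
      2 ^ ((Nat.log 2 n + c) ^ c) <
        complexity (perPoly (Fin n) ℝ≥0 * ∑ t, f t * g t) + complexity (∑ t, f t * g t) :=
  perDivisionHard_rowSplit

/-- Row cut, subexponential rank (p157525). [folklore] -/
theorem colContentSubexp :
    ∀ c : ℕ, ∃ e n₀ : ℕ, ∀ n ≥ n₀, ∀ h : MvPolynomial (Fin n × Fin n) ℝ≥0, h ≠ 0 →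
      ∀ A : Finset (Fin n), n ≤ 4 * A.card → 4 * A.card ≤ 3 * n →
      (h.support.image fun (mm : (Fin n × Fin n) →₀ ℕ) (cc : Fin n) => ∑ r ∈ A, mm (r, cc)).card ≤
          2 ^ (n / (Nat.log 2 n + e) ^ e) →
      2 ^ ((Nat.log 2 n + c) ^ c) <
        complexity (perPoly (Fin n) ℝ≥0 * h) + complexity h :=
  perDivisionHard_colContentSubexp

/-- Row-ROABPs: entries of `Ms₁.prod * Ms₂.prod` (p157525). [folklore] -/
theorem roabp :
    ∀ c : ℕ, ∃ n₀ : ℕ, ∀ n ≥ n₀, ∀ (W : ℕ) (A : Finset (Fin n))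
      (Ms₁ Ms₂ : List (Matrix (Fin W) (Fin W) (MvPolynomial (Fin n × Fin n) ℝ≥0))) (s₀ t₀ : Fin W),
      n ≤ 4 * A.card → 4 * A.card ≤ 3 * n → W ≤ 2 ^ ((Nat.log 2 n + c) ^ c) →
      (∀ M ∈ Ms₁, ∀ a b, ∀ mm ∈ (M a b).support, ∀ e ∈ mm.support, e.1 ∈ A) →
      (∀ M ∈ Ms₂, ∀ a b, ∀ mm ∈ (M a b).support, ∀ e ∈ mm.support, e.1 ∉ A) →
      (Ms₁.prod * Ms₂.prod) s₀ t₀ ≠ 0 →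
      2 ^ ((Nat.log 2 n + c) ^ c) <
        complexity (perPoly (Fin n) ℝ≥0 * (Ms₁.prod * Ms₂.prod) s₀ t₀) +
          complexity ((Ms₁.prod * Ms₂.prod) s₀ t₀) :=
  perDivisionHard_roabp

/-- Column cut (p157525). [folklore] -/
theorem rowContent :
    ∀ c : ℕ, ∃ n₀ : ℕ, ∀ n ≥ n₀, ∀ h : MvPolynomial (Fin n × Fin n) ℝ≥0, h ≠ 0 →
      ∀ B : Finset (Fin n), n ≤ 4 * B.card → 4 * B.card ≤ 3 * n →
      (h.support.image fun (mm : (Fin n × Fin n) →₀ ℕ) (r : Fin n) => ∑ cc ∈ B, mm (r, cc)).card ≤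
          2 ^ ((Nat.log 2 n + c) ^ c) →
      2 ^ ((Nat.log 2 n + c) ^ c) <
        complexity (perPoly (Fin n) ℝ≥0 * h) + complexity h :=
  perDivisionHard_rowContent

/-- Arbitrary balanced cell partition, quasi-polynomial rank (p159174). [folklore] -/
theorem cellContent :
    ∀ c : ℕ, ∃ n₀ : ℕ, ∀ n ≥ n₀, ∀ h : MvPolynomial (Fin n × Fin n) ℝ≥0, h ≠ 0 → ∀ Y : Finset (Fin n × Fin n),
      n * n ≤ 4 * Y.card → 4 * Y.card ≤ 3 * (n * n) →
      (h.support.image fun (mm : (Fin n × Fin n) →₀ ℕ) =>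
          ((fun r : Fin n => ∑ cc ∈ Finset.univ.filter (fun cc : Fin n => (r, cc) ∈ Y), mm (r, cc)),
           (fun cc : Fin n => ∑ r ∈ Finset.univ.filter (fun r : Fin n => (r, cc) ∈ Y), mm (r, cc)))).card ≤
        2 ^ ((Nat.log 2 n + c) ^ c) →
      2 ^ ((Nat.log 2 n + c) ^ c) < complexity (perPoly (Fin n) ℝ≥0 * h) + complexity h :=
  perDivisionHard_cellContent

/-- Pair interface of the cell rung: `(h, h')` with `h'` torus-homogeneous and no more expensive than `h` (p159174). [folklore] -/
theorem cellContentPair (c : ℕ) :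
    ∃ n₀ : ℕ, ∀ n ≥ n₀, ∀ h h' : MvPolynomial (Fin n × Fin n) ℝ≥0, h' ≠ 0 → IsTorusHomogeneous h' →
      complexity (perPoly (Fin n) ℝ≥0 * h') ≤ complexity (perPoly (Fin n) ℝ≥0 * h) →
      ∀ Y : Finset (Fin n × Fin n), n * n ≤ 4 * Y.card → 4 * Y.card ≤ 3 * (n * n) →
      (h'.support.image fun (mm : (Fin n × Fin n) →₀ ℕ) =>
          ((fun r : Fin n => ∑ cc ∈ Finset.univ.filter (fun cc : Fin n => (r, cc) ∈ Y), mm (r, cc)),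
           (fun cc : Fin n => ∑ r ∈ Finset.univ.filter (fun r : Fin n => (r, cc) ∈ Y), mm (r, cc)))).card ≤
        2 ^ ((Nat.log 2 n + c) ^ c) →
      2 ^ ((Nat.log 2 n + c) ^ c) < complexity (perPoly (Fin n) ℝ≥0 * h) + complexity h :=
  two_pow_lt_pair_of_cellContent c

/-- Cell-split sums `Σ f_t(x_Y)·g_t(x_Yᶜ)` (p159525). [folklore] -/
theorem cellSplit :
    ∀ c : ℕ, ∃ n₀ : ℕ, ∀ n ≥ n₀, ∀ (W : ℕ) (Y : Finset (Fin n × Fin n))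
      (f g : Fin W → MvPolynomial (Fin n × Fin n) ℝ≥0),
      n * n ≤ 4 * Y.card → 4 * Y.card ≤ 3 * (n * n) → W ≤ 2 ^ ((Nat.log 2 n + c) ^ c) →
      ∑ t, f t * g t ≠ 0 →
      (∀ t, ∀ mm ∈ (f t).support, ∀ e ∈ mm.support, e ∈ Y) →
      (∀ t, ∀ mm ∈ (g t).support, ∀ e ∈ mm.support, e ∉ Y) →
      2 ^ ((Nat.log 2 n + c) ^ c) <
        complexity (perPoly (Fin n) ℝ≥0 * ∑ t, f t * g t) + complexity (∑ t, f t * g t) :=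
  perDivisionHard_cellSplit

/-- Oblivious ABPs in any variable order, split at a balanced point (p159525). [folklore] -/
theorem oabp :
    ∀ c : ℕ, ∃ n₀ : ℕ, ∀ n ≥ n₀, ∀ (W : ℕ) (Y : Finset (Fin n × Fin n))
      (Ms₁ Ms₂ : List (Matrix (Fin W) (Fin W) (MvPolynomial (Fin n × Fin n) ℝ≥0))) (s₀ t₀ : Fin W),
      n * n ≤ 4 * Y.card → 4 * Y.card ≤ 3 * (n * n) → W ≤ 2 ^ ((Nat.log 2 n + c) ^ c) →
      (∀ M ∈ Ms₁, ∀ a b, ∀ mm ∈ (M a b).support, ∀ e ∈ mm.support, e ∈ Y) →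
      (∀ M ∈ Ms₂, ∀ a b, ∀ mm ∈ (M a b).support, ∀ e ∈ mm.support, e ∉ Y) →
      (Ms₁.prod * Ms₂.prod) s₀ t₀ ≠ 0 →
      2 ^ ((Nat.log 2 n + c) ^ c) <
        complexity (perPoly (Fin n) ℝ≥0 * (Ms₁.prod * Ms₂.prod) s₀ t₀) +
          complexity ((Ms₁.prod * Ms₂.prod) s₀ t₀) :=
  perDivisionHard_oabp

/-- Arbitrary balanced cell partition, subexponential rank (p159525). [folklore] -/
theorem cellContentSubexp :
    ∀ c : ℕ, ∃ e n₀ : ℕ, ∀ n ≥ n₀, ∀ h : MvPolynomial (Fin n × Fin n) ℝ≥0, h ≠ 0 → ∀ Y : Finset (Fin n × Fin n),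
      n * n ≤ 4 * Y.card → 4 * Y.card ≤ 3 * (n * n) →
      (h.support.image fun (mm : (Fin n × Fin n) →₀ ℕ) =>
          ((fun r : Fin n => ∑ cc ∈ Finset.univ.filter (fun cc : Fin n => (r, cc) ∈ Y), mm (r, cc)),
           (fun cc : Fin n => ∑ r ∈ Finset.univ.filter (fun r : Fin n => (r, cc) ∈ Y), mm (r, cc)))).card ≤
        2 ^ (n / (Nat.log 2 n + e) ^ e) →
      2 ^ ((Nat.log 2 n + c) ^ c) < complexity (perPoly (Fin n) ℝ≥0 * h) + complexity h :=
  perDivisionHard_cellContentSubexp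
/-- Products of arbitrarily many factors with contents in a common small set (p160827). [folklore] -/
theorem lowRankProduct :
    ∀ c : ℕ, ∃ n₀ : ℕ, ∀ n ≥ n₀, ∀ (s : ℕ) (Y : Finset (Fin n × Fin n))
      (f : Fin s → MvPolynomial (Fin n × Fin n) ℝ≥0),
      n * n ≤ 4 * Y.card → 4 * Y.card ≤ 3 * (n * n) → ∏ i, f i ≠ 0 →
      (Finset.univ.biUnion fun i => (f i).support.image fun (mm : (Fin n × Fin n) →₀ ℕ) =>
          ((fun r : Fin n => ∑ cc ∈ Finset.univ.filter (fun cc : Fin n => (r, cc) ∈ Y), mm (r, cc)),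
           (fun cc : Fin n => ∑ r ∈ Finset.univ.filter (fun r : Fin n => (r, cc) ∈ Y), mm (r, cc)))).card ≤
        2 ^ ((Nat.log 2 n + c) ^ c) →
      2 ^ ((Nat.log 2 n + c) ^ c) <
        complexity (perPoly (Fin n) ℝ≥0 * ∏ i, f i) + complexity (∏ i, f i) :=
  perDivisionHard_lowRankProduct

/-- Low partial degree in the variables of a balanced half, arbitrary in the other half (p160262). [folklore] -/
theorem lowPartialDegree :
    ∀ c : ℕ, ∃ n₀ : ℕ, ∀ n ≥ n₀, ∀ h : MvPolynomial (Fin n × Fin n) ℝ≥0, h ≠ 0 →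
      ∀ (Y : Finset (Fin n × Fin n)) (d : ℕ), n * n ≤ 4 * Y.card → 4 * Y.card ≤ 3 * (n * n) →
      (∀ mm ∈ h.support, ∑ e ∈ Y, mm e ≤ d) → (n * n + 1) ^ (2 * d) ≤ 2 ^ ((Nat.log 2 n + c) ^ c) →
      2 ^ ((Nat.log 2 n + c) ^ c) < complexity (perPoly (Fin n) ℝ≥0 * h) + complexity h :=
  perDivisionHard_lowPartialDegree

end Summit.ValiantsHypothesis.ValiantsHypothesis.Cruxes.PerDivisionHard.PairDescentJssEndpoint.RankChapter

end
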